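import Literature.MathematicalPhysics.QuantumFieldTheory.Balaban1983to89.B6Eq292MemberTorusV1L0
import Literature.MathematicalPhysics.QuantumFieldTheory.Balaban1983to89.B6Prop26KLevelSkeletonV2L0
import Literature.MathematicalPhysics.QuantumFieldTheory.Balaban1983to89.B6AgreeQaQV1Chart
import Literature.MathematicalPhysics.QuantumFieldTheory.Balaban1983to89.B6CubeCoeffSizesV1L0
import Literature.MathematicalPhysics.QuantumFieldTheory.Balaban1983to89.B6CubeMoutV1
/-!
# `Balaban1983to89.B6CubeMoutV1L0` — LEVEL-0 TWIN (programme G-F3′-L0, director-ym LINE №27 / UV3-NODE §24.5; plan `lit-balaban-r03/G-F3L0-PLAN.md`) of `B6CubeMoutV1`: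
the same declarations, SAME NAMES AND STATEMENTS, for nested families WITH print's region `Λ₀ = T ∖ Ω₁` ADMITTED (structures
`B6MultiLevelBoxOperatorL0.Domains` / `B6MultiLevelTorusOperatorL0.TDomains`: levels `0, …, k`, the level-`0` block a single site, `Q′₀ = id`,
finite weight `a₀` — print p.225 (2.14) «Σ_{j=0}^k … (Q′₀λ)(x) = λ(x), x ∈ Λ₀», p.229 «taking a sequence (2.1) … smallest possible domains B^j(Λ_j),
and considering the operator Δ_a defined by (2.19), (2.20) for this sequence»).  Every `D`-free object is the lineage's, consumed BY NAME; no existing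
module is touched; no fact is minted.  Unit `lit-balaban-p33` (p33 gen 89; S-E entry twins named to p33 by the B6 owner r03 gen 36, ruling 2026-08-27T18:45:57Z; port tooling by r03 gen 36); B6 fold owner r03; referee ref-4.  THE TWIN'S DOCUMENTATION FOLLOWS
VERBATIM (its «levels 1 … k» / «Ω₁ = X» sentences describe the twin; here `j` runs from `0` and `Ω₁` may be a proper subset).

# `Balaban1983to89.B6CubeMoutV1` — T. Bałaban, *Propagators and renormalization transformations for lattice gauge theories. II*,
# Commun. Math. Phys. **96** (1984) 223–250 [Balaban1984PropagatorsII], (2.92)–(2.93) p. 239, p. 247 (the supports of h_□, ζ_□ lie in □̃ — a paraphrase of p. 239's ζ_□ sentence, not a quotation; v1.2 docfix):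
# THE OUTPUT LOCALISATION `hMout` OF `M_□h_□` OVER `□̃` FOR THE GENUINE MEMBER OF A CUBE ON THE GLOBAL TORUS — the local operator
# `M_□ = s(□)·τ_{−v}ε(Δ_□ + Q*a_□Q)ρτ_v` of `T_□` applied after the cut-off `h_□` has outputs on the blocks of `□̃ = QbigT □` (radius `7S/4`)

statement-level skeleton of published theorems with citation tags; proofs where landed; nothing here is a claim about the Yang–Mills mass gap

PDF held: `paper:balaban1984-cmp96-propagators-rt-ii` (journal page = PDF page + 222): p. 239 [PDF 17] re-read (text layer): *"On this torus we define
operators R, Δ_a as in (2.17), (2.19), but only two scales are present now … G_□ = (Δ − ∂P_□∂* + Q*aQ)⁻¹ (2.90) … K_{□,□}(x) = Σ_{b∈st(x)}(∂h_□)(b)(∂A_μ)(b)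
− (Δh_□)(x)A_μ(x) … (2.92)"*, p. 239 *"The function ζ_□ is of the same type as h_□, but it is equal to 1 on a cube containing □ … and it is equal to 0 outside a similar cube"*
(v1.2 DOCFIX, ref-4 D-g67-1: v1/v1.1 carried «these functions have supports in □̃» in quotation marks attributed to p. 247 — that clause is OUR
PARAPHRASE, not print; Lean content unchanged); [Balaban1984PropagatorsI] (1.8), (1.11) p. 19 (a block average
`(Q_kA)(c)` only sees the fine bonds of `B(c₋) ∪ B(c₊)`).

CITATION HEADER (lean-in-tree rule) — WHAT IS REPRODUCED.  Phase-2 file of the `lit-balaban` typed skeleton, seat **p38 gen 28**; the B6 fold owner r03's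
finding F5 (ii) (seat INBOX 2026-08-23T07:38Z/07:55Z: *"hMout : ∀ c, OutLoc (geomT D) (blkV1 hN D) (Ml c * mulOp (hB c)) (SbigT c) — needed because K's
first term (h_□M_□ − M_□h_□) contains M_□h_□ un-sandwiched"*) — the displayed hypothesis (ii) of `…B6Prop26KLevelAssemblyV1.prop26_2136_kLevel_assembly`
(p358050).  SKELETON rows **B6.Eq2.92** × **B6.Eq2.93** × **B6.Prop2.6** (cells only; decls of record untouched).  IMPORTS BY NAME, restating nothing:
`…B6Eq292MemberTorusV1` (`NC`, `EC`, `cfC`, `c0C`, `zC`, **`hdec_cube`**: `h_□M_□ − M_□h_□ = (Σ_e c_e·E_e − c₀·) + z·(Nh_□ − h_□N)`), `…B6CubeWindowV1` (`Ml`, `tC`, `hch`, `hch_deep`, `trV_hB`), `…B6AgreeQaQV1Chart` (`toMatrix'_memberQaQ`,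
`blocks_of_bondAvgIter_single_ne_zero`, `sitesPerDir_zero_eq_mul`), `…B6AgreeLapV1Chart` (`eS/eB`, `DeepS`, `cB`, `val_eS`, `apply_eq_sum_toMatrix`),
`…B6Prop26KLevelSkeletonV2` (`SbigT`, `blkV1_mem_SbigT_of_hB_ne_zero`, `ST_subset_SbigT`), `…B6Partition118KLevelTorusCentral` (`Dch`, `cc`, `QbigT`,
`blkDeep_of_hF_ne_zero`), `…B6Partition118KLevelFineLip` (`Qbig`, `mem_Qbig`), `…B6TorusDepthDistance` (`min_le_torusSupNorm_sub`), `…B6TranslateTorusV1`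
(`TB`, `vch`, `outLoc_conj_chart`, `mulOp_eq_conj`), `…B5Eq118OneStroke` (`iterBlockOf`, `val_iterBlockOf`), `…B6Prop26Gluing` (`OutLoc`, `outLoc_mulOp_mul`).

THIS FILE (0 sorry; standard axioms; THEOREMS ONLY — no `def`, no `def … : Prop` fact, no hypothesis-shaped fact).
* §1 LABELS: `one_lt_sitesPerDir`, `label_bounds` (`q·L^{j′} ≤ x − x₀ < (q+1)·L^{j′}` for the member `j′`-block label `q` of a charted window site),
  `label_window` (a site of margin `r·L^{j′}` has `r ≤ q < N′_{j′} − r`), `val_tgt` (the label of `β₊` is `a`, `a + 1`, or wraps to `0`),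
  **`abs_sub_lt_of_common_block`**: two window sites whose member `j′`-blocks are end-blocks of ONE member `j′`-bond, one of them of margin `4L^{j′}`, have
  labels `< 2L^{j′}` apart (the member torus does not wrap there).
* §2 **`exists_of_memberQaQ_ne_zero`**: a nonzero entry `(Q*a_□Q)(b′, b′₁)` of the member's sandwich forces a member index bond `β′` of level `j′ ∈ {j, j+1}`
  whose averages see both `δ_{b′}` and `δ_{b′₁}` (the kernel `Σ_{Λ^c} + Σ_{Λ′}` of `toMatrix'_memberQaQ`).
* §3 **`blkOf_mem_Qbig_of_near_hF`**: a chart site within torus distance `S/2` of `supp h^F_□` has its block in `Qbig` (radius `7S/4`; `M_h ≥ 8`: carriers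
  are `S_k`-deep so the torus distance is the box distance, block side `≤ L^{j+1} ≤ S/8`).
* §4 THE CUBE: `torusSupNorm_le_of_memberQaQ` (`(Q*a_□Q)(e b, e b₁) ≠ 0`, `h^ch_□(b₁) ≠ 0 ⟹ |b₋ − b₁₋|_T ≤ S/2`), **`outLoc_QaQ_hch_chart`** (chart frame:
  `(s(□)•ε(Q*a_□Q)ρ)·(h^ch_□·)` has outputs on the blocks of `Qbig`), **`outLoc_NC_hB`** (global frame by `outLoc_conj_chart`: `N·(h_□·)` has outputs on
  `SbigT □`), and the capstone **`outLoc_Ml_hB`**: `OutLoc (geomT D) (blkV1 hN D) (Ml □ * mulOp (hB □)) (SbigT □)` — by parts through `hdec_cube`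
  (`M_□h_□ = h_□M_□ − [(Σ_e c_e·E_e − c₀·) + z·(Nh_□ − h_□N)]`: `supp h_□ ⊂ □⁺ ⊂ □̃`, `supp c_e, supp c₀ ⊂ □⁺` — entering as the
  hypotheses `hcfT`/`hc0T`, literally r03's displayed hypotheses (iii), which p38's `…B6CubeCoeffSizesV1L0.cfC_supp`/`c0C_supp` (v1.1, p358610)
  discharge — and `N·(h_□·)`).
* §5 (v1.1, APPEND-ONLY; `import …B6CubeCoeffSizesV1` added) **`outLoc_Ml_hB'`**: the same with `hcfT`/`hc0T` DISCHARGED inside by `cfC_supp`/`c0C_supp`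
  (both in the tree, b1b9615ce29b) — hypothesis (ii) as a closed `∀ c` under the regime `M_h = L^a ≥ 8`, `R ≥ 2L²`, `P′ ≥ 5`, placed cube.

HONEST SCOPE / DIVERGENCES. (i) Lattice units, `η = 1`; V1 global torus, chart frame of the cube as in `…B6CubeWindowV1` (`M_h = L^a ≥ 8`, `R ≥ 2L²`,
`P′_μ ≥ 5`, placed cube).  (ii) Print's `□̃` is the cube of (2.93) («2/3M»); the tree's `□̃ = QbigT □` is p21/p38's block set of radius `7S/4` — the set over
which r03's assembly localises `K`; this file proves the localisation for THAT set (in fact the outputs of `M_□h_□` lie within `S + S/4 + L^{j+1}` of the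
centre).  (iii) Pure bookkeeping of supports: no estimate of [6] is involved; the only inputs are the locality of block averages ((1.8)/(1.11) of
[Balaban1984PropagatorsI], r03's `blocks_of_bondAvgIter_single_ne_zero`) and the depth of `supp h_□` in the window (`hch_deep`).  Nothing on d = 4 or the
continuum; NOT summit progress.  Unit `lit-balaban-p38` (gen 28: v1 p359177 b629576cfa6b; v1.1 §5), 2026-08-23.
-/

noncomputable section

open scoped BigOperators
open Finset

namespace Literature.MathematicalPhysics.QuantumFieldTheory.Balaban1983to89.B6CubeMoutV1L0

open LatticeFieldCalculus (bondAvgIter)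
open B4ContourShift (supNorm abs_le_supNorm)
open B4Reflection242 (boxDom)
open B4TorusKernel.MultiPeriod (torusSupNorm torusSupNorm_le_supNorm)
open B6MultiLevelBoxOperator (N0 bigSide)
open B6MultiLevelTorusOperator (one_le_of_mem)
open B6MultiLevelTorusOperatorL0 (TDomains)
open B6Geom246MultiLevelBox (toR supNorm_eq_dist)
open B6Geom246MultiLevelBoxL0 (bset blkOf dist_toR_cen_le cen)
open B6Geom246MultiLevelTorus (torusSupNorm_neg)
open B6Geom246MultiLevelTorusL0 (geomT blkMap)
open B6Cover236MultiLevelBlocksL0 (cubes side ctr)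
open B6Eq238MultiLevelTorus (svec)
open B6Partition118KLevelFineL0 (hF dist_lt_of_hF_ne_zero lev_window_of_dist_lt_three_halves)
open B6Partition118KLevelFineLipL0 (Qbig mem_Qbig)
open B6Partition118KLevelTorusCentralL0 (Dch cc QbigT side_cc level_bounds blkDeep_of_hF_ne_zero)
open B6TorusDepthDistance (SiteDeep min_le_torusSupNorm_sub)
open B6CubeWindowV1 (one_le_bigSide_real)
open B5Eq118OneStroke (iterBlockOf val_iterBlockOf)
open Literature.MathematicalPhysics.QuantumFieldTheory.Balaban1983to89.B6CubeMoutV1 (one_lt_sitesPerDir label_bounds label_window val_tgt abs_sub_lt_of_common_block exists_of_memberQaQ_ne_zero)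

variable {d ℓ : ℕ}

/-! ## §§1–2 of the original (`one_lt_sitesPerDir`, `label_bounds`, `label_window`, `val_tgt`, `abs_sub_lt_of_common_block`,
`exists_of_memberQaQ_ne_zero`: two-scale member labels and kernels) are `D`-free and are opened BY NAME above -/

/-! ## §3  Chart geometry: a site within torus distance `S/2` of `supp h^F_□` has its block in `Qbig` -/

section Geometry

variable {Mh k R : ℕ} {P : Fin (d + 1) → ℕ} (D : TDomains d ℓ Mh k P R)

/-- **THE BLOCKS WITHIN `S/2` OF `supp h^F_□` LIE IN `Qbig`** (`M_h ≥ 8`, `R ≥ 2L`, `P_μ ≥ 5`): `h^F_□(x′) ≠ 0`, `|x − x′|_T ≤ S/2 ⟹ y(x) ∈ Qbig □` (radius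
`7S/4`) — the carrier `x′` is `S_k`-deep so the torus distance is the box distance, `|x′ − ctr| < S`, and the block of `x` (level `≤ j+1`, side `≤ S/8`)
has its centre within `S + S/2 + S/16 ≤ 7S/4`. [cite: Balaban1984PropagatorsII, p.239 (supports of h_□, ζ_□ in □̃ — our paraphrase of p.239 «equal to 1 on a cube containing □ … equal to 0 outside a similar cube», not a printed sentence), p.235, (2.93) p.239, bookkeeping] -/
theorem blkOf_mem_Qbig_of_near_hF (hM8 : 8 ≤ Mh) (hR : 2 * (ℓ + 1) ≤ R) (hP5 : ∀ μ, 5 ≤ P μ) {hMh1 : 1 ≤ Mh} (hP4 : ∀ μ, 4 ≤ P μ)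
    (c : ↥(B6Cover236MultiLevelBlocksL0.cubes D.toDomains)) {x x' : ↥(boxDom (N0 ℓ Mh k P))} (h : hF (Dch D c) (cc D hMh1 hP4 c) x' ≠ 0)
    (hxx' : torusSupNorm (N0 ℓ Mh k P) (x.1 - x'.1) ≤ (bigSide ℓ Mh c.1.1 : ℝ) / 2) :
    blkOf (Dch D c) x ∈ Qbig (Dch D c) (cc D hMh1 hP4 c) := by
  have hMh : 2 ≤ Mh := le_trans (by norm_num) hM8
  have hx'c := dist_lt_of_hF_ne_zero (Dch D c) hMh1 h
  have hS : side (Dch D c) (cc D hMh1 hP4 c) = (bigSide ℓ Mh c.1.1 : ℝ) := side_cc hMh1 hP4 c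
  have hS1 : (1 : ℝ) ≤ (bigSide ℓ Mh c.1.1 : ℝ) := one_le_bigSide_real hMh1 c.1.1
  -- the carrier is `S_k`-deep: torus distance = box distance up to `S_k > S/2`
  have hdeep : SiteDeep (N0 ℓ Mh k P) ((bigSide ℓ Mh k : ℕ) : ℤ) x'.1 := (blkDeep_of_hF_ne_zero hMh hR hP5 c h).1 x' rfl
  have hjk : c.1.1 ≤ k := (level_bounds D.toDomains c).2
  have hSk : (bigSide ℓ Mh c.1.1 : ℝ) ≤ (bigSide ℓ Mh k : ℝ) := by
    unfold bigSide
    exact_mod_cast Nat.mul_le_mul_left Mh (Nat.pow_le_pow_right (by omega) (by omega))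
  have hw : (0 : ℤ) < ((bigSide ℓ Mh k : ℕ) : ℤ) := by
    have : (1 : ℝ) ≤ (bigSide ℓ Mh k : ℝ) := hS1.trans hSk
    exact_mod_cast (show 0 < bigSide ℓ Mh k by exact_mod_cast (by linarith : (0 : ℝ) < (bigSide ℓ Mh k : ℝ)))
  have key := min_le_torusSupNorm_sub hw hdeep x.2
  have hsym : torusSupNorm (N0 ℓ Mh k P) (x'.1 - x.1) = torusSupNorm (N0 ℓ Mh k P) (x.1 - x'.1) := by
    rw [show x'.1 - x.1 = -(x.1 - x'.1) by abel, torusSupNorm_neg (one_le_of_mem x.2)]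
  rw [hsym] at key
  have hnear : dist (toR x.1) (toR x'.1) ≤ (bigSide ℓ Mh c.1.1 : ℝ) / 2 := by
    rw [dist_comm, ← supNorm_eq_dist]
    rcases min_choice (supNorm (x'.1 - x.1)) ((((bigSide ℓ Mh k : ℕ) : ℤ) : ℝ)) with hm | hm
    · rw [hm] at key; exact key.trans hxx'
    · rw [hm] at key; push_cast at key; linarith
  -- the block of `x` has level `≤ j + 1`
  have h32 : dist (toR x.1) (ctr (Dch D c) (cc D hMh1 hP4 c)) < 3 / 2 * side (Dch D c) (cc D hMh1 hP4 c) := by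
    rw [hS]; linarith [dist_triangle (toR x.1) (toR x'.1) (ctr (Dch D c) (cc D hMh1 hP4 c))]
  have hlev := (lev_window_of_dist_lt_three_halves (Dch D c) hMh1 hR h32).2
  have hcen := dist_toR_cen_le (Dch D c) (rfl : blkOf (Dch D c) x = blkOf (Dch D c) x)
  have hL1 : 1 ≤ ℓ + 1 := by omega
  have hpow : (((ℓ + 1) ^ (blkOf (Dch D c) x).1.1 : ℕ) : ℝ) ≤ (((ℓ + 1) ^ (c.1.1 + 1) : ℕ) : ℝ) := by
    exact_mod_cast Nat.pow_le_pow_right hL1 hlev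
  have h8 : 8 * (((ℓ + 1) ^ (c.1.1 + 1) : ℕ) : ℝ) ≤ side (Dch D c) (cc D hMh1 hP4 c) := by
    rw [hS]; unfold bigSide; push_cast
    have : (8 : ℝ) ≤ Mh := by exact_mod_cast hM8
    have hp : (0 : ℝ) ≤ ((ℓ : ℝ) + 1) ^ (c.1.1 + 1) := by positivity
    nlinarith
  refine (mem_Qbig (Dch D c)).2 ?_
  rw [hS] at h8 hx'c ⊢
  calc dist (cen (Dch D c) (blkOf (Dch D c) x)) (ctr (Dch D c) (cc D hMh1 hP4 c))
      ≤ dist (toR x.1) (cen (Dch D c) (blkOf (Dch D c) x)) + dist (toR x.1) (ctr (Dch D c) (cc D hMh1 hP4 c)) :=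
        dist_triangle_left _ _ _
    _ ≤ dist (toR x.1) (cen (Dch D c) (blkOf (Dch D c) x)) + (dist (toR x.1) (toR x'.1) +
          dist (toR x'.1) (ctr (Dch D c) (cc D hMh1 hP4 c))) := by
        linarith [dist_triangle (toR x.1) (toR x'.1) (ctr (Dch D c) (cc D hMh1 hP4 c))]
    _ ≤ 7 / 4 * (bigSide ℓ Mh c.1.1 : ℝ) := by linarith

end Geometry

/-! ## §4  The cube: `N·(h_□·)` and `M_□·(h_□·)` have outputs on `□̃ = SbigT □` -/

section Cube

open B6Ineq2133TwoScaleV1 (onFun)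
open B6GlobalChartV1 (PV toBox toBox_apply)
open B6GlobalChartV1L0 (domT blkV1)
open B6SectAOperatorsV1 (BondIdx)
open B6Prop25TwoScaleCensus (TSIdx)
open B6AgreeLapV1Chart (cB eB eS DeepS mem_cB_W deepS_mono transplant_eB_eq apply_eq_sum_toMatrix)
open B6AgreeQaQV1Chart (blocks_of_bondAvgIter_single_ne_zero)
open B6Prop26ReachTransplant (restrictOp transplant transplant_apply restrictOp_apply chartBond)
open B6Prop26Gluing (mulOp mulOp_apply OutLoc outLoc_mulOp_mul)
open B6TranslateTorusV1 (vch TB TB_mul_TB_neg mulOp_eq_conj)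
open B6TranslateTorusV1L0 (outLoc_conj_chart)
open B6Prop26KLevelSkeletonV1L0 (hB ST)
open B6Prop26KLevelSkeletonV2L0 (SbigT mem_SbigT ST_subset_SbigT blkV1_mem_SbigT_of_hB_ne_zero)
open B6CubeWindowV1 (x0 Placed)
open B6CubeWindowV1L0 (tC tC_j sc hx0 hfit wC hch hch_apply hch_deep j0 j0_le_level Ml trV_hB)
open B6Eq292MemberTorusV1L0 (cfC c0C NC EC zC hdec_cube)

variable {hd : 1 ≤ d + 1} {hL : Odd (ℓ + 1) ∧ 1 < ℓ + 1} {a₀ a₁ : ℝ} {m K : ℕ} {Mh k R : ℕ} {P' : Fin (d + 1) → ℕ}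
variable (hN : ∀ μ, N0 ℓ Mh k P' μ = (PV d ℓ m K hd hL).sitesPerDir 0) {D : TDomains d ℓ Mh k P' R} (hk : k ≤ m + K)
  (hMh1 : 1 ≤ Mh) (hP4 : ∀ μ, 4 ≤ P' μ) {a : ℕ} (hMha : Mh = (ℓ + 1) ^ a) (c : ↥(cubes D.toDomains)) (ha : a₀ ≤ a₁)

include hMha in
/-- **A NONZERO ENTRY `(Q*a_□Q)(e b, e b₁)` WITH `h^ch_□(b₁) ≠ 0` PUTS `b₋` WITHIN `S/2` OF `b₁₋` ON THE TORUS** (`M_h ≥ 8`, `R ≥ 2L²`, window bond `b`):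
the two fine bonds lie under one member index bond of level `j′ ≤ j₀ + 1` (§2), `supp h^ch_□` has margin `4L^{j₀+1}` (`hch_deep`), so the labels are
`< 2L^{j′} ≤ 2L^{j+1} ≤ S/4` apart (§1). [cite: Balaban1984PropagatorsI, (1.8), (1.11) p.19; Balaban1984PropagatorsII, (2.89)–(2.90) p.239, p.238 (□ ⊂ □̃³)] -/
theorem torusSupNorm_le_of_memberQaQ (hM8 : 8 ≤ Mh) (hR2 : 2 * (ℓ + 1) ^ 2 ≤ R)
    (w : BondIdx (B6GlobalChartV1L0.domT hN D hk) → ℝ) (cf : ℝ) {b b₁ : PBond (PV d ℓ m K hd hL) 0}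
    (hb : b.src ∈ DeepS (tC hN hk hMh1 hP4 c ha a (wC hN hk c w) cf) (x0 ℓ Mh k c.1) 0) (hb₁ : hch hN hMh1 hP4 c b₁ ≠ 0)
    (hK : LinearMap.toMatrix' (onFun (LinearMap.adjoint (tC hN hk hMh1 hP4 c ha a (wC hN hk c w) cf).D.Q ∘ₗ
        (tC hN hk hMh1 hP4 c ha a (wC hN hk c w) cf).D.a ∘ₗ (tC hN hk hMh1 hP4 c ha a (wC hN hk c w) cf).D.Q))
        (eB (tC hN hk hMh1 hP4 c ha a (wC hN hk c w) cf) (x0 ℓ Mh k c.1) b)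
        (eB (tC hN hk hMh1 hP4 c ha a (wC hN hk c w) cf) (x0 ℓ Mh k c.1) b₁) ≠ 0) :
    torusSupNorm (N0 ℓ Mh k P') ((toBox hN b.src).1 - (toBox hN b₁.src).1) ≤ (bigSide ℓ Mh c.1.1 : ℝ) / 2 := by
  obtain ⟨j', hj', β', hA, hA₁⟩ := exists_of_memberQaQ_ne_zero _ hK
  have hj0 : (tC hN hk hMh1 hP4 c ha a (wC hN hk c w) cf).j = j0 hMh1 hP4 c := rfl
  have hj'le : j' ≤ j0 hMh1 hP4 c + 1 := by omega
  have hj't : j' ≤ (tC hN hk hMh1 hP4 c ha a (wC hN hk c w) cf).m + (tC hN hk hMh1 hP4 c ha a (wC hN hk c w) cf).K := by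
    have := (tC hN hk hMh1 hP4 c ha a (wC hN hk c w) cf).hj
    omega
  -- `supp h^ch_□` has margin `4L^{j₀+1} ≥ 4L^{j′}`
  have hdeep₁ : b₁.src ∈ DeepS (tC hN hk hMh1 hP4 c ha a (wC hN hk c w) cf) (x0 ℓ Mh k c.1) (4 * (ℓ + 1) ^ j') :=
    deepS_mono (Nat.mul_le_mul_left 4 (Nat.pow_le_pow_right (by omega) hj'le)) (hch_deep hN hMh1 hP4 hMha c ha hM8 hR2 hb₁)
  -- the member blocks of `e b₋`, `e b₁₋` are end-blocks of `β′`
  have hBy := (blocks_of_bondAvgIter_single_ne_zero (P := (tC hN hk hMh1 hP4 c ha a (wC hN hk c w) cf).P) hj't hA).1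
  have hB₁ := (blocks_of_bondAvgIter_single_ne_zero (P := (tC hN hk hMh1 hP4 c ha a (wC hN hk c w) cf).P) hj't hA₁).1
  have hco : ∀ μ, |((b.src μ).val : ℤ) - (b₁.src μ).val| < 2 * (((ℓ + 1) ^ j' : ℕ) : ℤ) :=
    fun μ => abs_sub_lt_of_common_block hj't hb hdeep₁ hBy hB₁ μ
  -- torus distance ≤ label distance `< 2L^{j′} ≤ 2L^{j+1} ≤ S/4`
  have hN1 : ∀ i, 1 ≤ N0 ℓ Mh k P' i := one_le_of_mem (toBox hN b.src).2
  refine le_trans (torusSupNorm_le_supNorm hN1 _) ?_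
  have hjc : j' ≤ c.1.1 + 1 := le_trans hj'le (by have := (j0_le_level hMh1 hP4 c hL hR2).1; omega)
  have hl1 : (1 : ℝ) ≤ (ℓ : ℝ) + 1 := by have : (0 : ℝ) ≤ ℓ := Nat.cast_nonneg _; linarith
  have hpow : ((ℓ : ℝ) + 1) ^ j' ≤ ((ℓ : ℝ) + 1) ^ (c.1.1 + 1) := pow_le_pow_right₀ hl1 hjc
  have hM : (8 : ℝ) ≤ Mh := by exact_mod_cast hM8
  have eS : (bigSide ℓ Mh c.1.1 : ℝ) = (Mh : ℝ) * ((ℓ : ℝ) + 1) ^ (c.1.1 + 1) := by unfold bigSide; push_cast; ring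
  have hp0 : (0 : ℝ) ≤ ((ℓ : ℝ) + 1) ^ j' := by positivity
  refine Finset.sup'_le _ _ fun μ _ => ?_
  have hμ : (((|((toBox hN b.src).1 - (toBox hN b₁.src).1) μ| : ℤ)) : ℝ) ≤ 2 * ((ℓ : ℝ) + 1) ^ j' := by
    have h := (hco μ).le
    have : (((|((b.src μ).val : ℤ) - (b₁.src μ).val| : ℤ)) : ℝ) ≤ (((2 * (((ℓ + 1) ^ j' : ℕ) : ℤ)) : ℤ) : ℝ) := by exact_mod_cast h
    simpa using this
  rw [eS]
  nlinarith [mul_le_mul_of_nonneg_right hM (le_trans hp0 hpow)]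

include hMha in
/-- **`(s(□)•ε(Q*a_□Q)ρ)·(h^ch_□·)` HAS OUTPUTS ON THE BLOCKS OF `Qbig` (CHART FRAME)**: a nonzero output at a window bond `b` needs a window bond `b₁`
with `h^ch_□(b₁) ≠ 0` and `(Q*a_□Q)(e b, e b₁) ≠ 0`, whence `|b₋ − b₁₋|_T ≤ S/2` and the block of `b₋` is in `Qbig` (§3); off the window `ε = 0`.
[cite: Balaban1984PropagatorsII, (2.92)–(2.93) p.239 (supports of h_□, ζ_□ in □̃ — our paraphrase of p.239 «equal to 1 on a cube containing □ … equal to 0 outside a similar cube», not a printed sentence), p.247; Balaban1984PropagatorsI, (1.8), (1.11) p.19] -/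
theorem outLoc_QaQ_hch_chart (hM8 : 8 ≤ Mh) (hR2 : 2 * (ℓ + 1) ^ 2 ≤ R) (hP5 : ∀ μ, 5 ≤ P' μ) (hpl : Placed ℓ k P' c.1)
    (w : BondIdx (B6GlobalChartV1L0.domT hN D hk) → ℝ) (cf : ℝ) :
    OutLoc (g := geomT (D.chart (svec ℓ k c.1.1 c.1.2))) (blkV1 hN (D.chart (svec ℓ k c.1.1 c.1.2)))
      ((sc hMh1 hP4 c cf • transplant (cB (tC hN hk hMh1 hP4 c ha a (wC hN hk c w) cf) (x0 ℓ Mh k c.1) (hx0 hpl) (hfit hN hMh1 hP4 hMha c ha hpl)).W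
          (eB (tC hN hk hMh1 hP4 c ha a (wC hN hk c w) cf) (x0 ℓ Mh k c.1))
          (onFun (LinearMap.adjoint (tC hN hk hMh1 hP4 c ha a (wC hN hk c w) cf).D.Q ∘ₗ (tC hN hk hMh1 hP4 c ha a (wC hN hk c w) cf).D.a ∘ₗ
            (tC hN hk hMh1 hP4 c ha a (wC hN hk c w) cf).D.Q))) *
        mulOp (hch hN hMh1 hP4 c))
      {y | y ∈ Qbig (Dch D c) (cc D hMh1 hP4 c)} := by
  have hR : 2 * (ℓ + 1) ≤ R := le_trans (by nlinarith : 2 * (ℓ + 1) ≤ 2 * (ℓ + 1) ^ 2) hR2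
  intro v b hb
  rw [Module.End.mul_apply, LinearMap.smul_apply, Pi.smul_apply, smul_eq_mul, transplant_apply]
  by_cases hW : b ∈ (cB (tC hN hk hMh1 hP4 c ha a (wC hN hk c w) cf) (x0 ℓ Mh k c.1) (hx0 hpl) (hfit hN hMh1 hP4 hMha c ha hpl)).W
  · rw [if_pos hW]
    refine mul_eq_zero_of_right _ ?_
    rw [apply_eq_sum_toMatrix]
    refine Finset.sum_eq_zero fun b'₁ _ => ?_
    by_contra hne
    obtain ⟨hK, hρ⟩ := mul_ne_zero_iff.1 hne
    rw [restrictOp_apply] at hρ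
    obtain ⟨b₁, hb₁W, hg⟩ := Finset.exists_ne_zero_of_sum_ne_zero hρ
    rw [Finset.mem_filter] at hb₁W
    rw [mulOp_apply] at hg
    have hch₁ : hch hN hMh1 hP4 c b₁ ≠ 0 := (mul_ne_zero_iff.1 hg).1
    rw [← hb₁W.2] at hK
    have hdist := torusSupNorm_le_of_memberQaQ hN hk hMh1 hP4 hMha c ha hM8 hR2 w cf (mem_cB_W.1 hW) hch₁ hK
    rw [hch_apply] at hch₁
    exact hb (blkOf_mem_Qbig_of_near_hF D hM8 hR hP5 hP4 c hch₁ hdist)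
  · rw [if_neg hW, mul_zero]

/-- `OutLoc` is additive. [folklore] -/
private theorem outLoc_add' {g : B6.Geometry} {X : Type} (blk : X → g.Site) {T T' : Module.End ℝ (X → ℝ)} {S : Set g.Site}
    (h : OutLoc blk T S) (h' : OutLoc blk T' S) : OutLoc blk (T + T') S := by
  intro v x hx
  rw [LinearMap.add_apply, Pi.add_apply, h v x hx, h' v x hx, add_zero]

/-- `OutLoc` passes to differences. [folklore] -/
private theorem outLoc_sub' {g : B6.Geometry} {X : Type} (blk : X → g.Site) {T T' : Module.End ℝ (X → ℝ)} {S : Set g.Site}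
    (h : OutLoc blk T S) (h' : OutLoc blk T' S) : OutLoc blk (T - T') S := by
  intro v x hx
  rw [LinearMap.sub_apply, Pi.sub_apply, h v x hx, h' v x hx, sub_zero]

/-- `OutLoc` passes to finite sums. [folklore] -/
private theorem outLoc_sum' {g : B6.Geometry} {X : Type} (blk : X → g.Site) {ι : Type} (s : Finset ι) {T : ι → Module.End ℝ (X → ℝ)}
    {S : Set g.Site} (h : ∀ i ∈ s, OutLoc blk (T i) S) : OutLoc blk (∑ i ∈ s, T i) S := by
  classical
  induction s using Finset.induction_on with
  | empty => intro v x _; simp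
  | insert i s hi ih =>
    rw [Finset.sum_insert hi]
    exact outLoc_add' blk (h i (Finset.mem_insert_self i s)) (ih fun i' hi' => h i' (Finset.mem_insert_of_mem hi'))

/-- a further left multiplication keeps `OutLoc`. [folklore] -/
private theorem outLoc_mulOp_left' {g : B6.Geometry} {X : Type} (blk : X → g.Site) (z : X → ℝ) {T : Module.End ℝ (X → ℝ)} {S : Set g.Site}
    (h : OutLoc blk T S) : OutLoc blk (mulOp z * T) S := by
  intro v x hx
  rw [Module.End.mul_apply, mulOp_apply, h v x hx, mul_zero]

include hMha in
/-- **`N·(h_□·)` HAS OUTPUTS ON `□̃ = SbigT □`** (global frame): `N = τ_{−v}(s(□)•ε(Q*a_□Q)ρ)τ_v`, `h_□· = τ_{−v}(h^ch_□·)τ_v`, so `N·(h_□·)` is the conjugate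
of the chart-frame operator of `outLoc_QaQ_hch_chart`, and `SbigT □` is the block-map image of `Qbig` (`outLoc_conj_chart`).
[cite: Balaban1984PropagatorsII, (2.92)–(2.93) p.239, p.247, dictionary (charts)] -/
theorem outLoc_NC_hB (hM8 : 8 ≤ Mh) (hR2 : 2 * (ℓ + 1) ^ 2 ≤ R) (hP5 : ∀ μ, 5 ≤ P' μ) (hpl : Placed ℓ k P' c.1)
    (w : BondIdx (B6GlobalChartV1L0.domT hN D hk) → ℝ) (cf : ℝ) :
    OutLoc (g := geomT D) (blkV1 hN D) (NC hN hk hMh1 hP4 hMha c ha hpl w cf * mulOp (hB hN D c)) (SbigT D hMh1 hP4 c) := by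
  have hP : ∀ μ, 1 ≤ P' μ := fun μ => le_trans (by norm_num) (hP4 μ)
  -- `h_□· = τ_{−v}(h^ch_□·)τ_v`
  have hh : TB (-vch (ℓ := ℓ) (m := m) (K := K) (hd := hd) (hL := hL) Mh k (svec ℓ k c.1.1 c.1.2)) * mulOp (hch hN hMh1 hP4 c) *
      TB (vch Mh k (svec ℓ k c.1.1 c.1.2)) = mulOp (hB hN D c) := by
    rw [← trV_hB hN hMh1 hP4 c, ← mulOp_eq_conj]
  have e : NC hN hk hMh1 hP4 hMha c ha hpl w cf * mulOp (hB hN D c) =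
      TB (-vch (ℓ := ℓ) (m := m) (K := K) (hd := hd) (hL := hL) Mh k (svec ℓ k c.1.1 c.1.2)) *
        ((sc hMh1 hP4 c cf • transplant (cB (tC hN hk hMh1 hP4 c ha a (wC hN hk c w) cf) (x0 ℓ Mh k c.1) (hx0 hpl) (hfit hN hMh1 hP4 hMha c ha hpl)).W
            (eB (tC hN hk hMh1 hP4 c ha a (wC hN hk c w) cf) (x0 ℓ Mh k c.1))
            (onFun (LinearMap.adjoint (tC hN hk hMh1 hP4 c ha a (wC hN hk c w) cf).D.Q ∘ₗ (tC hN hk hMh1 hP4 c ha a (wC hN hk c w) cf).D.a ∘ₗ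
              (tC hN hk hMh1 hP4 c ha a (wC hN hk c w) cf).D.Q))) *
          mulOp (hch hN hMh1 hP4 c)) *
        TB (vch Mh k (svec ℓ k c.1.1 c.1.2)) := by
    rw [← hh, NC, ← transplant_eB_eq]
    simp only [mul_assoc]
    rw [← mul_assoc (TB (vch Mh k (svec ℓ k c.1.1 c.1.2))) (TB (-vch Mh k (svec ℓ k c.1.1 c.1.2))), TB_mul_TB_neg, one_mul]
  rw [e]
  have key := outLoc_conj_chart hN D hMh1 hP (svec ℓ k c.1.1 c.1.2) (outLoc_QaQ_hch_chart hN hk hMh1 hP4 hMha c ha hM8 hR2 hP5 hpl w cf)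
  -- the block-map image of `Qbig` is `SbigT □`
  intro v x hx
  refine key v x fun hx' => hx ?_
  obtain ⟨x', hx'Q, hx'e⟩ := hx'
  have hmem : blkMap D (svec ℓ k c.1.1 c.1.2) x' ∈ QbigT D hMh1 hP4 c := Finset.mem_image_of_mem _ hx'Q
  rw [hx'e] at hmem
  exact (mem_SbigT D hMh1 hP4 c _).2 hmem

include hMha in
/-- **`hMout` FOR THE GENUINE MEMBER OF THE CUBE**: `OutLoc (geomT D) (blkV1 hN D) (Ml □ * mulOp (hB □)) (SbigT □)` — `M_□h_□ = h_□M_□ − (h_□M_□ − M_□h_□)`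
with `hdec_cube`: `h_□M_□` and `h_□N` are cut off by `supp h_□ ⊂ □⁺ ⊂ □̃`, the line-1 pieces by `supp c_e, supp c₀ ⊂ □⁺` (the hypotheses `hcfT`, `hc0T`: r03's
displayed hypotheses (iii), discharged by `…B6CubeCoeffSizesV1L0.cfC_supp`/`c0C_supp`), and `z·N·(h_□·)` by `outLoc_NC_hB` — the displayed hypothesis (ii)
of r03's `prop26_2136_kLevel_assembly` (`M_h = L^a ≥ 8`, `R ≥ 2L²`, `P′ ≥ 5`, placed cube).
[cite: Balaban1984PropagatorsII, (2.92)–(2.93) p.239 (supports of h_□, ζ_□ in □̃ — our paraphrase of p.239 «equal to 1 on a cube containing □ … equal to 0 outside a similar cube», not a printed sentence), (2.90)–(2.91) p.239, p.247] -/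
theorem outLoc_Ml_hB (hM8 : 8 ≤ Mh) (hR2 : 2 * (ℓ + 1) ^ 2 ≤ R) (hP5 : ∀ μ, 5 ≤ P' μ) (hpl : Placed ℓ k P' c.1)
    (w : BondIdx (B6GlobalChartV1L0.domT hN D hk) → ℝ) (cf : ℝ)
    (hcfT : ∀ (e : Fin (d + 1) × Bool) (x : PBond (PV d ℓ m K hd hL) 0),
      cfC hN hk hMh1 hP4 hMha c ha hpl w cf e x ≠ 0 → blkV1 hN D x ∈ ST D hMh1 hP4 c)
    (hc0T : ∀ x : PBond (PV d ℓ m K hd hL) 0, c0C hN hk hMh1 hP4 hMha c ha hpl w cf x ≠ 0 → blkV1 hN D x ∈ ST D hMh1 hP4 c) :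
    OutLoc (g := geomT D) (blkV1 hN D) (Ml hN hk hMh1 hP4 hMha c ha hpl w cf * mulOp (hB hN D c)) (SbigT D hMh1 hP4 c) := by
  have hMh : 2 ≤ Mh := le_trans (by norm_num) hM8
  have hR : 2 * (ℓ + 1) ≤ R := le_trans (by nlinarith : 2 * (ℓ + 1) ≤ 2 * (ℓ + 1) ^ 2) hR2
  have hBsupp : ∀ x, hB hN D c x ≠ 0 → blkV1 hN D x ∈ SbigT D hMh1 hP4 c :=
    fun x hx => blkV1_mem_SbigT_of_hB_ne_zero hN D hMh hR hP4 c hx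
  have e : Ml hN hk hMh1 hP4 hMha c ha hpl w cf * mulOp (hB hN D c) =
      mulOp (hB hN D c) * Ml hN hk hMh1 hP4 hMha c ha hpl w cf -
        (mulOp (hB hN D c) * Ml hN hk hMh1 hP4 hMha c ha hpl w cf - Ml hN hk hMh1 hP4 hMha c ha hpl w cf * mulOp (hB hN D c)) :=
    (sub_sub_cancel _ _).symm
  rw [e, hdec_cube hN hk hMh1 hP4 hMha c ha hM8 hR2 hpl w cf]
  refine outLoc_sub' _ (outLoc_mulOp_mul _ hBsupp _) (outLoc_add' _ (outLoc_sub' _ ?_ ?_) (outLoc_sum' _ _ fun _ _ => ?_))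
  · exact outLoc_sum' _ _ fun e _ =>
      outLoc_mulOp_mul _ (fun x hx => ST_subset_SbigT D hMh1 hP4 c (hcfT e x hx)) _
  · intro v x hx
    rw [mulOp_apply]
    have h0 : c0C hN hk hMh1 hP4 hMha c ha hpl w cf x = 0 := by
      by_contra hne
      exact hx (ST_subset_SbigT D hMh1 hP4 c (hc0T x hne))
    rw [h0, zero_mul]
  · exact outLoc_mulOp_left' _ _ (outLoc_sub' _ (outLoc_NC_hB hN hk hMh1 hP4 hMha c ha hM8 hR2 hP5 hpl w cf) (outLoc_mulOp_mul _ hBsupp _))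

end Cube

/-! ## §5  (v1.1) `hMout` with the line-1 supports discharged -/

section Discharged

open B6GlobalChartV1 (PV)
open B6GlobalChartV1L0 (domT blkV1)
open B6SectAOperatorsV1 (BondIdx)
open B6Prop26Gluing (mulOp OutLoc)
open B6Prop26KLevelSkeletonV1L0 (hB)
open B6Prop26KLevelSkeletonV2L0 (SbigT)
open B6CubeWindowV1 (Placed)
open B6CubeWindowV1L0 (Ml)
open B6CubeCoeffSizesV1L0 (cfC_supp c0C_supp)

variable {hd : 1 ≤ d + 1} {hL : Odd (ℓ + 1) ∧ 1 < ℓ + 1} {a₀ a₁ : ℝ} {m K : ℕ} {Mh k R : ℕ} {P' : Fin (d + 1) → ℕ}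
variable (hN : ∀ μ, N0 ℓ Mh k P' μ = (PV d ℓ m K hd hL).sitesPerDir 0) {D : TDomains d ℓ Mh k P' R} (hk : k ≤ m + K)
  (hMh1 : 1 ≤ Mh) (hP4 : ∀ μ, 4 ≤ P' μ) {a : ℕ} (hMha : Mh = (ℓ + 1) ^ a) (c : ↥(cubes D.toDomains)) (ha : a₀ ≤ a₁)

/-- **`hMout` FOR THE GENUINE MEMBER OF THE CUBE, CLOSED FORM**: `OutLoc (geomT D) (blkV1 hN D) (Ml □ * mulOp (hB □)) (SbigT □)` under `M_h = L^a ≥ 8`,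
`R ≥ 2L²`, `P′ ≥ 5`, placed cube — `outLoc_Ml_hB` with the supports of `c_e`, `c₀` supplied by `…B6CubeCoeffSizesV1L0.cfC_supp`/`c0C_supp`; the displayed
hypothesis (ii) of r03's `prop26_2136_kLevel_assembly` by name. [cite: Balaban1984PropagatorsII, (2.92)–(2.93) p.239 (supports of h_□, ζ_□ in □̃ — our paraphrase of p.239 «equal to 1 on a cube containing □ … equal to 0 outside a similar cube», not a printed sentence), (2.90)–(2.91) p.239, p.247] -/
theorem outLoc_Ml_hB' (hM8 : 8 ≤ Mh) (hR2 : 2 * (ℓ + 1) ^ 2 ≤ R) (hP5 : ∀ μ, 5 ≤ P' μ) (hpl : Placed ℓ k P' c.1)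
    (w : BondIdx (B6GlobalChartV1L0.domT hN D hk) → ℝ) (cf : ℝ) :
    OutLoc (g := geomT D) (blkV1 hN D) (Ml hN hk hMh1 hP4 hMha c ha hpl w cf * mulOp (hB hN D c)) (SbigT D hMh1 hP4 c) :=
  outLoc_Ml_hB hN hk hMh1 hP4 hMha c ha hM8 hR2 hP5 hpl w cf
    (fun e x hx => cfC_supp hN hk hMh1 hP4 hMha c ha hM8 hR2 hP5 hpl w cf e x hx)
    (fun x hx => c0C_supp hN hk hMh1 hP4 hMha c ha hM8 hR2 hP5 hpl w cf x hx)

end Discharged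

end Literature.MathematicalPhysics.QuantumFieldTheory.Balaban1983to89.B6CubeMoutV1L0
end
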